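/-
Copyright (c) 2026 the pub-hodgecm-mathlib formalisation cell (harness21).  Prover seat hodgecm-mathlib-LH7-p06 (g3), req620 Track A «(D-RAM) FOUR-FRAME» squad
((β₂) road (R-36), the K6 road; K6 desk LH4-p16 (g3) WORD #1 (a) «(f′) by the TABLE ROAD (R2)» — its n-half: the weighted cell sizes of the live row at EVERY conductor exponent `d`,
the all-`d` dress of ★ p863247 (which stops at `d = 2`) over ★ p861408's general-`d` branch readers), 2026-09-05.
-/
import Summits.HodgeConjecture.HodgeConjecture.Theorems.F0P3cDyRamBeta2ConesRowSizes   -- ★ p863247 (LH7-p10 (g2)): `rowSize_eq_pow_mul_ncard`, `rowSize_diag`, `two_le_d`; brings ★ p861408 `ncard_levelSet_{near,boundary,far}_ramK_*`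
import HarnessLib

/-!
# Crux `H413`, line LH4 «(D-RAM) FOUR-FRAME» — (β₂) road, K6-(f′) by the table road, FILE 1: «THE CELL WEIGHTS OF THE LIVE ROW AT EVERY d» — `n(b+2i, b)` in closed form
# relative to `n(b, b) = q^{2b}` on the inner towers (`i + 1 < d`, both frames), the boundary tower (`i = d − 1`: HYP `(q−2)q^{d−2}`, ANISO `q^{d−1}`) and the far towers
# (`d ≤ i`: HYP `2(q−1)q^{i−1}`, ANISO `0`)

Cell `hodgecm-mathlib` (D-0151), FLOOR 0, crux item H413 = `stmt-HodgeConjecture-24833`, route of record `HCCMUnconditional`; squads F0∕P3c∕LH4 + LH7 (hand LH7-p06); lane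
`--supports stmt-HodgeConjecture-24833 --as helper` (count-neutral; pays NO tier-0 row).  THEOREMS ONLY (no `def`, no instance, no notation, no `sorry`, default heartbeats);
★-only imports; states NO law.  GENERIC ∕ DATUM-FREE: binders = ★ p863247's (`rowSize_far_hyp`'s block VERBATIM = a subset BY NAME AND BYTE of ‹OFF.letter.v1›'s general block +
the row letters `(b) (hb2 : 2 * b = m)`); `n(j, b) := ((Σᶠ Λ ∈ levelSetDep ρ Θ α (jE ϖ) h j b (lam − jE u₀₀), f b j Λ : ℕ) : ℤ)` (the letters' weighted size, K6-0's `n`).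
WHY (K6 desk LH4-p16 (g3) WORD #1 (a); β₂ sub-dealer LH4-p04 (g10) 01:47:05Z (2); SIG `F0/P3c/LH7/LH7-p06/g3/SIG-K6fprime-R2.v1.LH7p06g3.txt`).  ‹K6-(f′) UNIFORM FIBRE› by the table road is
`n_t(i) = k·L_t(i)` cell by cell from (1) the weighted sizes `n_t(i)` — THIS FILE, every `d` (★ p863247 = the `d = 2` case; ‹CORE-3›∕‹CORE-ODD› need `d ≥ 3`) — and (2) the digit-split
counts `L_t(i)` per shell (K6-(d′)∕(d″): shell totals `(q−1)q^{i−1}β` and the class split — half∕half inside, `(q−2) : q` on the boundary shell, one-class beyond); then `k = 2q^{2b}∕β`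
serves EVERY window cell and both frames (the arithmetic is checked in the SIG).  Mechanism = ★ p863247's: ★ `rowSize_eq_pow_mul_ncard` (`Σᶠ f = q^b·#levelSet` on low cells
`2b ≤ m`, `j + b ≤ jl`) × ★ p861408's general-`d` readers `ncard_levelSet_near_ramK` ∕ `…boundary_ramK_hyper∕aniso` ∕ `…far_ramK_hyper∕aniso` at `(j, a) = (b + 2i, b)`, ÷ ★ `rowSize_diag`.
* §1 `rowSize_near` (inner towers, both frames); §2 `rowSize_boundary_hyp_allD`, `rowSize_boundary_aniso_allD`; §3 `rowSize_far_hyp_allD`, `rowSize_far_aniso_allD`.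
HONEST LABEL.  Count-neutral index bookkeeping over ★ tables; nothing printed is asserted; no census law is stated; ‹K6-(f′)›∕‹CORE›∕(β₂) stay HYPOTHESES; `HC_CM` is proved only
modulo the 7 printed citations (2 remaining named inputs: hLiu418 = `stmt-HodgeConjecture-24832`, h413 = `stmt-HodgeConjecture-24833`) until rung 0 closes.
## References
* [Kottwitz1986BaseChangeUnits] R. E. Kottwitz, *Base change for unit elements of Hecke algebras*, Compositio Math. 60 (1986), §1 pp. 240–241 (cell-by-cell weighted lattice counts).
* [Flicker1998UnitaryFL] Y. Z. Flicker, *Elementary proof of the fundamental lemma for a unitary group*, Canad. J. Math. 50 (1998), Prop. 7 p. 84 (torus-orbit census on the tree).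
* [Serre1979] J.-P. Serre, *Local Fields*, GTM 67 (1979), Ch. V §3 Prop. 5, Cor. 2–3 pp. 84–86 (norm subgroups, residue counts).
-/

set_option autoImplicit false

noncomputable section

namespace Summit.HodgeConjecture.HodgeConjecture.Cruxes.H413.F0P3cDyRamBeta2ConesRowSizesAllD

open scoped Matrix MatrixGroups Classical Valued WithZero
open WithZero
open Literature.NumberTheory.Automorphic Literature.NumberTheory.Automorphic.UnitaryThreeFourFrame Literature.NumberTheory.Automorphic.UnitaryLatticeTree
open Literature.NumberTheory.Automorphic.HermitianLattice Literature.NumberTheory.Automorphic.EllipticPlaneAsFieldLine Literature.NumberTheory.LocalFields.QuadraticOrder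
open Literature.NumberTheory.Rogawski1990
open Summit.HodgeConjecture.HodgeConjecture.Cruxes.H413.F0P3cDyRamToricCensusDefs Summit.HodgeConjecture.HodgeConjecture.Cruxes.H413.F0P3cDyRamFourFramePieces
open Summit.HodgeConjecture.HodgeConjecture.Cruxes.H413.F0P3cDyRamConeCellLedgerSizes Summit.HodgeConjecture.HodgeConjecture.Cruxes.H413.F0P3cDyRamConeCellDiagonalSize
open Summit.HodgeConjecture.HodgeConjecture.Cruxes.H413.F0P3cDyRamBeta2ConesRowSizes (two_le_d rowSize_eq_pow_mul_ncard rowSize_diag)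
open Summit.HodgeConjecture.HodgeConjecture.Cruxes.H413

variable {E M : Type} [Field E] [Valued E ℤᵐ⁰] [CompleteSpace E] [IsDiscreteValuationRing 𝒪[E]] [Finite 𝓀[E]]
  [Field M] [Valued M ℤᵐ⁰] [CompleteSpace M] [IsDiscreteValuationRing 𝒪[M]] [Finite 𝓀[M]]
  {σ : E →+* E} {ϖ : E} {d tE : ℕ} {jE : E →+* M} {ρ Θ : M →+* M} {α lam : M} {γ₂ : GL (Fin 2) E} {u : GL (Fin 1) E} {m jl : ℕ}
  {H₂ : Matrix (Fin 2) (Fin 2) E} {hW : E} {φ : (Fin 2 → E) →+ M} {h : M} {f : ℕ → ℕ → AddSubgroup M → ℕ}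

/-! ## §1 The inner towers (both frames) -/

/-- **(SIZE-NEAR) `n(b+2i, b) = (q − 1)·q^{i−1}·n(b, b)`** on the INNER towers `1 ≤ i`, `i + 1 < d` of the live row (`2b = m`, `2b + 2i ≤ jl`), EITHER frame (the two ★ tables coincide below the
boundary: ★ `ncard_levelSet_near_ramK` gives `(q−1)q^{j−1−(j−b)∕2}` at `j = b + 2i`). [cite: Flicker1998UnitaryFL, Prop. 7 p. 84] [cite: Kottwitz1986BaseChangeUnits, §1 pp. 240–241] -/
theorem rowSize_near (hD : IsRamifiedQuadraticDatum σ ϖ d tE) (hσσ : ∀ a, σ (σ a) = a) (h2 : ¬ IsUnit (2 : 𝒪[E]))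
    (hρρ : ∀ z, ρ (ρ z) = z) (hvρ : ∀ z, Valued.v (ρ z) = Valued.v z) (hρj : ∀ a, ρ (jE a) = jE a)
    (hjv : ∀ a, Valued.v (jE a) ≤ 1 ↔ Valued.v a ≤ 1) (hjfix : ∀ z : M, ρ z = z ↔ ∃ a, jE a = z) (hΘj : ∀ a, Θ (jE a) = jE (σ a))
    (hΘΘ : ∀ z, Θ (Θ z) = z) (hΘρ : ∀ z, Θ (ρ z) = ρ (Θ z)) (hvΘ : ∀ z, Valued.v (Θ z) = Valued.v z)
    (hα : ρ α ≠ α) (hα1 : Valued.v α ≤ 1) (hint : ∀ z : M, Valued.v z ≤ 1 → Valued.v ((z - ρ z) / (α - ρ α)) ≤ 1) (hvlam : Valued.v lam = 1)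
    (hU : Valued.v (α - ρ α) = 1) (hτ : Valued.v (α - Θ α) < 1) (hσres : ∀ z : M, ρ z = z → Valued.v z ≤ 1 → Valued.v (Θ z - z) < 1)
    (hDM : IsRamifiedQuadraticDatum Θ (jE ϖ) d tE) (hjiso : ∀ a, Valued.v (jE a) = Valued.v a) (hq : Nat.card 𝓀[M] = Nat.card 𝓀[E] ^ 2)
    (hjpow : ∀ (t : E) (n : ℤ), Valued.v (jE t) = Valued.v (jE ϖ) ^ n ↔ Valued.v t = Valued.v ϖ ^ n)
    (hϖmax : ∀ t : M, ρ t = t → Valued.v t < 1 → Valued.v t ≤ Valued.v (jE ϖ))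
    (hm : Valued.v (lam - jE ((u : Matrix (Fin 1) (Fin 1) E) 0 0)) = WithZero.exp (-(m : ℤ)))
    (hjl : Valued.v ((lam - jE ((u : Matrix (Fin 1) (Fin 1) E) 0 0)) - ρ (lam - jE ((u : Matrix (Fin 1) (Fin 1) E) 0 0))) = WithZero.exp (-(jl : ℤ)))
    (hH₂σ : (H₂.map σ)ᵀ = H₂) (hhW : Valued.v hW = 1) (hhWσ : σ hW = hW)
    (hφs : ∀ (c : E) (x : Fin 2 → E), φ (c • x) = jE c * φ x) (hφi : Function.Injective φ) (hφo : Function.Surjective φ)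
    (hφγ : ∀ x, φ ((γ₂ : Matrix (Fin 2) (Fin 2) E).mulVec x) = lam * φ x)
    (hform : ∀ x y, jE (pairing σ H₂ x y) = h * Θ (φ x) * φ y + ρ (h * Θ (φ x) * φ y)) (hΘh : Θ h = h) (hh : h ≠ 0)
    (hfinLS : ∀ j a, (levelSet ρ Θ α (jE ϖ) h j a).Finite)
    (hf : ∀ (b j : ℕ) (Λ : AddSubgroup M) (x₀ : M) (r : E), 1 ≤ b → x₀ ≠ 0 → (∀ x, x ∈ Λ ↔ ∃ z, IsOrd ρ α (jE ϖ ^ j) z ∧ x = x₀ * z) →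
      IsOrd ρ α (jE ϖ ^ j) (dualGen ρ Θ α (jE ϖ ^ j) h x₀) → ¬ IsOrd ρ α (jE ϖ ^ j) (dualGen ρ Θ α (jE ϖ ^ j) h x₀ / jE ϖ) → Valued.v (dualGen ρ Θ α (jE ϖ ^ j) h x₀) = Valued.v (jE ϖ) ^ b →
      (∀ b', (∀ x ∈ Λ, Valued.v (h * Θ x * b' + ρ (h * Θ x * b')) ≤ 1) → (lam - jE ((u : Matrix (Fin 1) (Fin 1) E) 0 0)) * b' ∈ Λ) → IsOrd ρ α (jE ϖ ^ j) lam →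
      jE r = glueUnit ρ Θ α (jE ϖ ^ j) h (jE ϖ) (jE hW) x₀ b →
      f b j Λ = Nat.card {x : 𝒪[E] ⧸ 𝓂[E] ^ (2 * b) // ∃ u' : 𝒪[E], Ideal.Quotient.mk (𝓂[E] ^ (2 * b)) u' = x ∧ Valued.v ((u' : E) * σ u' - r) ≤ Valued.v (ϖ ^ (2 * b))})
    (b : ℕ) (hb2 : 2 * b = m) (hb1 : 1 ≤ b) (i : ℕ) (hi1 : 1 ≤ i) (hid : i + 1 < d) (hjli : 2 * b + 2 * i ≤ jl) :
    ((∑ᶠ Λ ∈ levelSetDep ρ Θ α (jE ϖ) h (b + 2 * i) b (lam - jE ((u : Matrix (Fin 1) (Fin 1) E) 0 0)), f b (b + 2 * i) Λ : ℕ) : ℤ) =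
      ((Nat.card 𝓀[E] : ℤ) - 1) * (Nat.card 𝓀[E] : ℤ) ^ (i - 1) * ((∑ᶠ Λ ∈ levelSetDep ρ Θ α (jE ϖ) h b b (lam - jE ((u : Matrix (Fin 1) (Fin 1) E) 0 0)), f b b Λ : ℕ) : ℤ) := by
  have hq1 : 1 ≤ Nat.card 𝓀[E] := Nat.card_pos
  rw [rowSize_diag hD hσσ h2 hρρ hvρ hρj hjv hjfix hΘj hΘΘ hΘρ hvΘ hα hα1 hint hvlam hU hτ hσres hDM hjiso hq hjpow hϖmax hm hjl hH₂σ hhW hhWσ hφs hφi hφo hφγ hform hΘh hh hfinLS hf b hb2 hb1, rowSize_eq_pow_mul_ncard hD hσσ h2 hρρ hvρ hρj hjv hjfix hΘj hΘΘ hΘρ hvΘ hα hα1 hint hvlam hU hτ hσres hDM hjiso hq hjpow hϖmax hm hjl hH₂σ hhW hhWσ hφs hφi hφo hφγ hform hΘh hh hfinLS hf hb1 (by omega) (by omega),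
    ncard_levelSet_near_ramK hρρ hvρ hΘρ hα1 hU hDM (hρj ϖ) hΘh hh hq hσres hτ hb1 (by omega) (by omega) (by omega),
    show b + 2 * i - 1 - (b + 2 * i - b) / 2 = b + (i - 1) by omega]
  push_cast [Nat.cast_sub hq1]; ring

/-! ## §2 The boundary tower at every `d` -/

/-- **(SIZE-BOUNDARY-H) `n(b+2(d−1), b) = (q − 2)·q^{d−2}·n(b, b)`** on the BOUNDARY tower `i = d − 1` of the live row, hyperbolic (isotropic) plane, every `d ≥ 2` (★
`ncard_levelSet_boundary_ramK_hyper`: `(q−2)q^{j−d}` at `j + 2 = b + 2d`). [cite: Flicker1998UnitaryFL, Prop. 7 p. 84] [cite: Kottwitz1986BaseChangeUnits, §1 pp. 240–241] -/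
theorem rowSize_boundary_hyp_allD (hD : IsRamifiedQuadraticDatum σ ϖ d tE) (hσσ : ∀ a, σ (σ a) = a) (h2 : ¬ IsUnit (2 : 𝒪[E]))
    (hρρ : ∀ z, ρ (ρ z) = z) (hvρ : ∀ z, Valued.v (ρ z) = Valued.v z) (hρj : ∀ a, ρ (jE a) = jE a)
    (hjv : ∀ a, Valued.v (jE a) ≤ 1 ↔ Valued.v a ≤ 1) (hjfix : ∀ z : M, ρ z = z ↔ ∃ a, jE a = z) (hΘj : ∀ a, Θ (jE a) = jE (σ a))
    (hΘΘ : ∀ z, Θ (Θ z) = z) (hΘρ : ∀ z, Θ (ρ z) = ρ (Θ z)) (hvΘ : ∀ z, Valued.v (Θ z) = Valued.v z)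
    (hα : ρ α ≠ α) (hα1 : Valued.v α ≤ 1) (hint : ∀ z : M, Valued.v z ≤ 1 → Valued.v ((z - ρ z) / (α - ρ α)) ≤ 1) (hvlam : Valued.v lam = 1)
    (hU : Valued.v (α - ρ α) = 1) (hτ : Valued.v (α - Θ α) < 1) (hσres : ∀ z : M, ρ z = z → Valued.v z ≤ 1 → Valued.v (Θ z - z) < 1)
    (hDM : IsRamifiedQuadraticDatum Θ (jE ϖ) d tE) (hjiso : ∀ a, Valued.v (jE a) = Valued.v a) (hq : Nat.card 𝓀[M] = Nat.card 𝓀[E] ^ 2)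
    (hjpow : ∀ (t : E) (n : ℤ), Valued.v (jE t) = Valued.v (jE ϖ) ^ n ↔ Valued.v t = Valued.v ϖ ^ n)
    (hϖmax : ∀ t : M, ρ t = t → Valued.v t < 1 → Valued.v t ≤ Valued.v (jE ϖ))
    (hm : Valued.v (lam - jE ((u : Matrix (Fin 1) (Fin 1) E) 0 0)) = WithZero.exp (-(m : ℤ)))
    (hjl : Valued.v ((lam - jE ((u : Matrix (Fin 1) (Fin 1) E) 0 0)) - ρ (lam - jE ((u : Matrix (Fin 1) (Fin 1) E) 0 0))) = WithZero.exp (-(jl : ℤ)))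
    (hH₂σ : (H₂.map σ)ᵀ = H₂) (hhW : Valued.v hW = 1) (hhWσ : σ hW = hW)
    (hφs : ∀ (c : E) (x : Fin 2 → E), φ (c • x) = jE c * φ x) (hφi : Function.Injective φ) (hφo : Function.Surjective φ)
    (hφγ : ∀ x, φ ((γ₂ : Matrix (Fin 2) (Fin 2) E).mulVec x) = lam * φ x)
    (hform : ∀ x y, jE (pairing σ H₂ x y) = h * Θ (φ x) * φ y + ρ (h * Θ (φ x) * φ y)) (hΘh : Θ h = h) (hh : h ≠ 0)
    (hfinLS : ∀ j a, (levelSet ρ Θ α (jE ϖ) h j a).Finite)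
    (hf : ∀ (b j : ℕ) (Λ : AddSubgroup M) (x₀ : M) (r : E), 1 ≤ b → x₀ ≠ 0 → (∀ x, x ∈ Λ ↔ ∃ z, IsOrd ρ α (jE ϖ ^ j) z ∧ x = x₀ * z) →
      IsOrd ρ α (jE ϖ ^ j) (dualGen ρ Θ α (jE ϖ ^ j) h x₀) → ¬ IsOrd ρ α (jE ϖ ^ j) (dualGen ρ Θ α (jE ϖ ^ j) h x₀ / jE ϖ) → Valued.v (dualGen ρ Θ α (jE ϖ ^ j) h x₀) = Valued.v (jE ϖ) ^ b →
      (∀ b', (∀ x ∈ Λ, Valued.v (h * Θ x * b' + ρ (h * Θ x * b')) ≤ 1) → (lam - jE ((u : Matrix (Fin 1) (Fin 1) E) 0 0)) * b' ∈ Λ) → IsOrd ρ α (jE ϖ ^ j) lam →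
      jE r = glueUnit ρ Θ α (jE ϖ ^ j) h (jE ϖ) (jE hW) x₀ b →
      f b j Λ = Nat.card {x : 𝒪[E] ⧸ 𝓂[E] ^ (2 * b) // ∃ u' : 𝒪[E], Ideal.Quotient.mk (𝓂[E] ^ (2 * b)) u' = x ∧ Valued.v ((u' : E) * σ u' - r) ≤ Valued.v (ϖ ^ (2 * b))})
    (b : ℕ) (hb2 : 2 * b = m) (hb1 : 1 ≤ b) (hiso : ∃ x : M, x ≠ 0 ∧ h * Θ x * x + ρ (h * Θ x * x) = 0) (i : ℕ) (hid : i + 1 = d) (hjli : 2 * b + 2 * i ≤ jl) :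
    ((∑ᶠ Λ ∈ levelSetDep ρ Θ α (jE ϖ) h (b + 2 * i) b (lam - jE ((u : Matrix (Fin 1) (Fin 1) E) 0 0)), f b (b + 2 * i) Λ : ℕ) : ℤ) =
      ((Nat.card 𝓀[E] : ℤ) - 2) * (Nat.card 𝓀[E] : ℤ) ^ (i - 1) * ((∑ᶠ Λ ∈ levelSetDep ρ Θ α (jE ϖ) h b b (lam - jE ((u : Matrix (Fin 1) (Fin 1) E) 0 0)), f b b Λ : ℕ) : ℤ) := by
  have hd2 := (two_le_d hD h2).2
  have hq2 : 2 ≤ Nat.card 𝓀[E] := by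
    have := (two_le_d hD h2).1
    exact Nat.succ_le_of_lt (Finite.one_lt_card_iff_nontrivial.2 inferInstance)
  rw [rowSize_diag hD hσσ h2 hρρ hvρ hρj hjv hjfix hΘj hΘΘ hΘρ hvΘ hα hα1 hint hvlam hU hτ hσres hDM hjiso hq hjpow hϖmax hm hjl hH₂σ hhW hhWσ hφs hφi hφo hφγ hform hΘh hh hfinLS hf b hb2 hb1, rowSize_eq_pow_mul_ncard hD hσσ h2 hρρ hvρ hρj hjv hjfix hΘj hΘΘ hΘρ hvΘ hα hα1 hint hvlam hU hτ hσres hDM hjiso hq hjpow hϖmax hm hjl hH₂σ hhW hhWσ hφs hφi hφo hφγ hform hΘh hh hfinLS hf hb1 (by omega) (by omega),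
    ncard_levelSet_boundary_ramK_hyper hρρ hvρ hΘρ hα1 hU hDM (hρj ϖ) hΘh hh hq hσres hτ hiso hd2 hb1 (by omega),
    show b + 2 * i - d = b + (i - 1) by omega]
  push_cast [Nat.cast_sub hq2]; ring

/-- **(SIZE-BOUNDARY-A) `n(b+2(d−1), b) = q^{d−1}·n(b, b)`** on the BOUNDARY tower `i = d − 1` of the live row, anisotropic plane, every `d ≥ 2` (★ `ncard_levelSet_boundary_ramK_aniso`:
`q^{j−d+1}` at `j + 2 = b + 2d`). [cite: Flicker1998UnitaryFL, Prop. 7 p. 84] [cite: Kottwitz1986BaseChangeUnits, §1 pp. 240–241] -/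
theorem rowSize_boundary_aniso_allD (hD : IsRamifiedQuadraticDatum σ ϖ d tE) (hσσ : ∀ a, σ (σ a) = a) (h2 : ¬ IsUnit (2 : 𝒪[E]))
    (hρρ : ∀ z, ρ (ρ z) = z) (hvρ : ∀ z, Valued.v (ρ z) = Valued.v z) (hρj : ∀ a, ρ (jE a) = jE a)
    (hjv : ∀ a, Valued.v (jE a) ≤ 1 ↔ Valued.v a ≤ 1) (hjfix : ∀ z : M, ρ z = z ↔ ∃ a, jE a = z) (hΘj : ∀ a, Θ (jE a) = jE (σ a))
    (hΘΘ : ∀ z, Θ (Θ z) = z) (hΘρ : ∀ z, Θ (ρ z) = ρ (Θ z)) (hvΘ : ∀ z, Valued.v (Θ z) = Valued.v z)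
    (hα : ρ α ≠ α) (hα1 : Valued.v α ≤ 1) (hint : ∀ z : M, Valued.v z ≤ 1 → Valued.v ((z - ρ z) / (α - ρ α)) ≤ 1) (hvlam : Valued.v lam = 1)
    (hU : Valued.v (α - ρ α) = 1) (hτ : Valued.v (α - Θ α) < 1) (hσres : ∀ z : M, ρ z = z → Valued.v z ≤ 1 → Valued.v (Θ z - z) < 1)
    (hDM : IsRamifiedQuadraticDatum Θ (jE ϖ) d tE) (hjiso : ∀ a, Valued.v (jE a) = Valued.v a) (hq : Nat.card 𝓀[M] = Nat.card 𝓀[E] ^ 2)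
    (hjpow : ∀ (t : E) (n : ℤ), Valued.v (jE t) = Valued.v (jE ϖ) ^ n ↔ Valued.v t = Valued.v ϖ ^ n)
    (hϖmax : ∀ t : M, ρ t = t → Valued.v t < 1 → Valued.v t ≤ Valued.v (jE ϖ))
    (hm : Valued.v (lam - jE ((u : Matrix (Fin 1) (Fin 1) E) 0 0)) = WithZero.exp (-(m : ℤ)))
    (hjl : Valued.v ((lam - jE ((u : Matrix (Fin 1) (Fin 1) E) 0 0)) - ρ (lam - jE ((u : Matrix (Fin 1) (Fin 1) E) 0 0))) = WithZero.exp (-(jl : ℤ)))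
    (hH₂σ : (H₂.map σ)ᵀ = H₂) (hhW : Valued.v hW = 1) (hhWσ : σ hW = hW)
    (hφs : ∀ (c : E) (x : Fin 2 → E), φ (c • x) = jE c * φ x) (hφi : Function.Injective φ) (hφo : Function.Surjective φ)
    (hφγ : ∀ x, φ ((γ₂ : Matrix (Fin 2) (Fin 2) E).mulVec x) = lam * φ x)
    (hform : ∀ x y, jE (pairing σ H₂ x y) = h * Θ (φ x) * φ y + ρ (h * Θ (φ x) * φ y)) (hΘh : Θ h = h) (hh : h ≠ 0)
    (hfinLS : ∀ j a, (levelSet ρ Θ α (jE ϖ) h j a).Finite)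
    (hf : ∀ (b j : ℕ) (Λ : AddSubgroup M) (x₀ : M) (r : E), 1 ≤ b → x₀ ≠ 0 → (∀ x, x ∈ Λ ↔ ∃ z, IsOrd ρ α (jE ϖ ^ j) z ∧ x = x₀ * z) →
      IsOrd ρ α (jE ϖ ^ j) (dualGen ρ Θ α (jE ϖ ^ j) h x₀) → ¬ IsOrd ρ α (jE ϖ ^ j) (dualGen ρ Θ α (jE ϖ ^ j) h x₀ / jE ϖ) → Valued.v (dualGen ρ Θ α (jE ϖ ^ j) h x₀) = Valued.v (jE ϖ) ^ b →
      (∀ b', (∀ x ∈ Λ, Valued.v (h * Θ x * b' + ρ (h * Θ x * b')) ≤ 1) → (lam - jE ((u : Matrix (Fin 1) (Fin 1) E) 0 0)) * b' ∈ Λ) → IsOrd ρ α (jE ϖ ^ j) lam →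
      jE r = glueUnit ρ Θ α (jE ϖ ^ j) h (jE ϖ) (jE hW) x₀ b →
      f b j Λ = Nat.card {x : 𝒪[E] ⧸ 𝓂[E] ^ (2 * b) // ∃ u' : 𝒪[E], Ideal.Quotient.mk (𝓂[E] ^ (2 * b)) u' = x ∧ Valued.v ((u' : E) * σ u' - r) ≤ Valued.v (ϖ ^ (2 * b))})
    (b : ℕ) (hb2 : 2 * b = m) (hb1 : 1 ≤ b) (haniso : ¬ ∃ x : M, x ≠ 0 ∧ h * Θ x * x + ρ (h * Θ x * x) = 0) (i : ℕ) (hid : i + 1 = d) (hjli : 2 * b + 2 * i ≤ jl) :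
    ((∑ᶠ Λ ∈ levelSetDep ρ Θ α (jE ϖ) h (b + 2 * i) b (lam - jE ((u : Matrix (Fin 1) (Fin 1) E) 0 0)), f b (b + 2 * i) Λ : ℕ) : ℤ) =
      (Nat.card 𝓀[E] : ℤ) ^ i * ((∑ᶠ Λ ∈ levelSetDep ρ Θ α (jE ϖ) h b b (lam - jE ((u : Matrix (Fin 1) (Fin 1) E) 0 0)), f b b Λ : ℕ) : ℤ) := by
  have hd2 := (two_le_d hD h2).2
  rw [rowSize_diag hD hσσ h2 hρρ hvρ hρj hjv hjfix hΘj hΘΘ hΘρ hvΘ hα hα1 hint hvlam hU hτ hσres hDM hjiso hq hjpow hϖmax hm hjl hH₂σ hhW hhWσ hφs hφi hφo hφγ hform hΘh hh hfinLS hf b hb2 hb1, rowSize_eq_pow_mul_ncard hD hσσ h2 hρρ hvρ hρj hjv hjfix hΘj hΘΘ hΘρ hvΘ hα hα1 hint hvlam hU hτ hσres hDM hjiso hq hjpow hϖmax hm hjl hH₂σ hhW hhWσ hφs hφi hφo hφγ hform hΘh hh hfinLS hf hb1 (by omega) (by omega),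
    ncard_levelSet_boundary_ramK_aniso hρρ hvρ hΘρ hα1 hU hDM (hρj ϖ) hΘh hh hq hσres hτ haniso hd2 hb1 (by omega),
    show b + 2 * i - d + 1 = b + i by omega]
  push_cast; ring

/-! ## §3 The far towers at every `d` -/

/-- **(SIZE-FAR-H) `n(b+2i, b) = 2(q − 1)·q^{i−1}·n(b, b)`** on the FAR towers `d ≤ i` of the live row, hyperbolic plane, every `d` (★ `ncard_levelSet_far_ramK_hyper`:
`2(q−1)q^{j−1−(j−b)∕2}` at `j = b + 2i`, `b + 2d ≤ j`). [cite: Flicker1998UnitaryFL, Prop. 7 p. 84] [cite: Kottwitz1986BaseChangeUnits, §1 pp. 240–241] -/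
theorem rowSize_far_hyp_allD (hD : IsRamifiedQuadraticDatum σ ϖ d tE) (hσσ : ∀ a, σ (σ a) = a) (h2 : ¬ IsUnit (2 : 𝒪[E]))
    (hρρ : ∀ z, ρ (ρ z) = z) (hvρ : ∀ z, Valued.v (ρ z) = Valued.v z) (hρj : ∀ a, ρ (jE a) = jE a)
    (hjv : ∀ a, Valued.v (jE a) ≤ 1 ↔ Valued.v a ≤ 1) (hjfix : ∀ z : M, ρ z = z ↔ ∃ a, jE a = z) (hΘj : ∀ a, Θ (jE a) = jE (σ a))
    (hΘΘ : ∀ z, Θ (Θ z) = z) (hΘρ : ∀ z, Θ (ρ z) = ρ (Θ z)) (hvΘ : ∀ z, Valued.v (Θ z) = Valued.v z)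
    (hα : ρ α ≠ α) (hα1 : Valued.v α ≤ 1) (hint : ∀ z : M, Valued.v z ≤ 1 → Valued.v ((z - ρ z) / (α - ρ α)) ≤ 1) (hvlam : Valued.v lam = 1)
    (hU : Valued.v (α - ρ α) = 1) (hτ : Valued.v (α - Θ α) < 1) (hσres : ∀ z : M, ρ z = z → Valued.v z ≤ 1 → Valued.v (Θ z - z) < 1)
    (hDM : IsRamifiedQuadraticDatum Θ (jE ϖ) d tE) (hjiso : ∀ a, Valued.v (jE a) = Valued.v a) (hq : Nat.card 𝓀[M] = Nat.card 𝓀[E] ^ 2)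
    (hjpow : ∀ (t : E) (n : ℤ), Valued.v (jE t) = Valued.v (jE ϖ) ^ n ↔ Valued.v t = Valued.v ϖ ^ n)
    (hϖmax : ∀ t : M, ρ t = t → Valued.v t < 1 → Valued.v t ≤ Valued.v (jE ϖ))
    (hm : Valued.v (lam - jE ((u : Matrix (Fin 1) (Fin 1) E) 0 0)) = WithZero.exp (-(m : ℤ)))
    (hjl : Valued.v ((lam - jE ((u : Matrix (Fin 1) (Fin 1) E) 0 0)) - ρ (lam - jE ((u : Matrix (Fin 1) (Fin 1) E) 0 0))) = WithZero.exp (-(jl : ℤ)))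
    (hH₂σ : (H₂.map σ)ᵀ = H₂) (hhW : Valued.v hW = 1) (hhWσ : σ hW = hW)
    (hφs : ∀ (c : E) (x : Fin 2 → E), φ (c • x) = jE c * φ x) (hφi : Function.Injective φ) (hφo : Function.Surjective φ)
    (hφγ : ∀ x, φ ((γ₂ : Matrix (Fin 2) (Fin 2) E).mulVec x) = lam * φ x)
    (hform : ∀ x y, jE (pairing σ H₂ x y) = h * Θ (φ x) * φ y + ρ (h * Θ (φ x) * φ y)) (hΘh : Θ h = h) (hh : h ≠ 0)
    (hfinLS : ∀ j a, (levelSet ρ Θ α (jE ϖ) h j a).Finite)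
    (hf : ∀ (b j : ℕ) (Λ : AddSubgroup M) (x₀ : M) (r : E), 1 ≤ b → x₀ ≠ 0 → (∀ x, x ∈ Λ ↔ ∃ z, IsOrd ρ α (jE ϖ ^ j) z ∧ x = x₀ * z) →
      IsOrd ρ α (jE ϖ ^ j) (dualGen ρ Θ α (jE ϖ ^ j) h x₀) → ¬ IsOrd ρ α (jE ϖ ^ j) (dualGen ρ Θ α (jE ϖ ^ j) h x₀ / jE ϖ) → Valued.v (dualGen ρ Θ α (jE ϖ ^ j) h x₀) = Valued.v (jE ϖ) ^ b →
      (∀ b', (∀ x ∈ Λ, Valued.v (h * Θ x * b' + ρ (h * Θ x * b')) ≤ 1) → (lam - jE ((u : Matrix (Fin 1) (Fin 1) E) 0 0)) * b' ∈ Λ) → IsOrd ρ α (jE ϖ ^ j) lam →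
      jE r = glueUnit ρ Θ α (jE ϖ ^ j) h (jE ϖ) (jE hW) x₀ b →
      f b j Λ = Nat.card {x : 𝒪[E] ⧸ 𝓂[E] ^ (2 * b) // ∃ u' : 𝒪[E], Ideal.Quotient.mk (𝓂[E] ^ (2 * b)) u' = x ∧ Valued.v ((u' : E) * σ u' - r) ≤ Valued.v (ϖ ^ (2 * b))})
    (b : ℕ) (hb2 : 2 * b = m) (hb1 : 1 ≤ b) (hiso : ∃ x : M, x ≠ 0 ∧ h * Θ x * x + ρ (h * Θ x * x) = 0) (i : ℕ) (hdi : d ≤ i) (hjli : 2 * b + 2 * i ≤ jl) :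
    ((∑ᶠ Λ ∈ levelSetDep ρ Θ α (jE ϖ) h (b + 2 * i) b (lam - jE ((u : Matrix (Fin 1) (Fin 1) E) 0 0)), f b (b + 2 * i) Λ : ℕ) : ℤ) =
      2 * ((Nat.card 𝓀[E] : ℤ) - 1) * (Nat.card 𝓀[E] : ℤ) ^ (i - 1) * ((∑ᶠ Λ ∈ levelSetDep ρ Θ α (jE ϖ) h b b (lam - jE ((u : Matrix (Fin 1) (Fin 1) E) 0 0)), f b b Λ : ℕ) : ℤ) := by
  have hq1 : 1 ≤ Nat.card 𝓀[E] := Nat.card_pos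
  have hd1 : 1 ≤ d := hD.2.2.2.2.2.1
  rw [rowSize_diag hD hσσ h2 hρρ hvρ hρj hjv hjfix hΘj hΘΘ hΘρ hvΘ hα hα1 hint hvlam hU hτ hσres hDM hjiso hq hjpow hϖmax hm hjl hH₂σ hhW hhWσ hφs hφi hφo hφγ hform hΘh hh hfinLS hf b hb2 hb1, rowSize_eq_pow_mul_ncard hD hσσ h2 hρρ hvρ hρj hjv hjfix hΘj hΘΘ hΘρ hvΘ hα hα1 hint hvlam hU hτ hσres hDM hjiso hq hjpow hϖmax hm hjl hH₂σ hhW hhWσ hφs hφi hφo hφγ hform hΘh hh hfinLS hf hb1 (by omega) (by omega),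
    ncard_levelSet_far_ramK_hyper hρρ hvρ hΘρ hα1 hU hDM (hρj ϖ) hΘh hh hq hσres hτ hiso hb1 (by omega) (by omega),
    show b + 2 * i - 1 - (b + 2 * i - b) / 2 = b + (i - 1) by omega]
  push_cast [Nat.cast_sub hq1]; ring

/-- **(SIZE-FAR-A) `n(b+2i, b) = 0`** on the FAR towers `d ≤ i` of the live row, anisotropic plane, every `d` (★ `ncard_levelSet_far_ramK_aniso`: the anisotropic far shells are EMPTY —
the A-window cut of ★ p864238 §2). [cite: Flicker1998UnitaryFL, Prop. 7 p. 84] [cite: Kottwitz1986BaseChangeUnits, §1 pp. 240–241] -/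
theorem rowSize_far_aniso_allD (hD : IsRamifiedQuadraticDatum σ ϖ d tE) (hσσ : ∀ a, σ (σ a) = a) (h2 : ¬ IsUnit (2 : 𝒪[E]))
    (hρρ : ∀ z, ρ (ρ z) = z) (hvρ : ∀ z, Valued.v (ρ z) = Valued.v z) (hρj : ∀ a, ρ (jE a) = jE a)
    (hjv : ∀ a, Valued.v (jE a) ≤ 1 ↔ Valued.v a ≤ 1) (hjfix : ∀ z : M, ρ z = z ↔ ∃ a, jE a = z) (hΘj : ∀ a, Θ (jE a) = jE (σ a))
    (hΘΘ : ∀ z, Θ (Θ z) = z) (hΘρ : ∀ z, Θ (ρ z) = ρ (Θ z)) (hvΘ : ∀ z, Valued.v (Θ z) = Valued.v z)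
    (hα : ρ α ≠ α) (hα1 : Valued.v α ≤ 1) (hint : ∀ z : M, Valued.v z ≤ 1 → Valued.v ((z - ρ z) / (α - ρ α)) ≤ 1) (hvlam : Valued.v lam = 1)
    (hU : Valued.v (α - ρ α) = 1) (hτ : Valued.v (α - Θ α) < 1) (hσres : ∀ z : M, ρ z = z → Valued.v z ≤ 1 → Valued.v (Θ z - z) < 1)
    (hDM : IsRamifiedQuadraticDatum Θ (jE ϖ) d tE) (hjiso : ∀ a, Valued.v (jE a) = Valued.v a) (hq : Nat.card 𝓀[M] = Nat.card 𝓀[E] ^ 2)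
    (hjpow : ∀ (t : E) (n : ℤ), Valued.v (jE t) = Valued.v (jE ϖ) ^ n ↔ Valued.v t = Valued.v ϖ ^ n)
    (hϖmax : ∀ t : M, ρ t = t → Valued.v t < 1 → Valued.v t ≤ Valued.v (jE ϖ))
    (hm : Valued.v (lam - jE ((u : Matrix (Fin 1) (Fin 1) E) 0 0)) = WithZero.exp (-(m : ℤ)))
    (hjl : Valued.v ((lam - jE ((u : Matrix (Fin 1) (Fin 1) E) 0 0)) - ρ (lam - jE ((u : Matrix (Fin 1) (Fin 1) E) 0 0))) = WithZero.exp (-(jl : ℤ)))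
    (hH₂σ : (H₂.map σ)ᵀ = H₂) (hhW : Valued.v hW = 1) (hhWσ : σ hW = hW)
    (hφs : ∀ (c : E) (x : Fin 2 → E), φ (c • x) = jE c * φ x) (hφi : Function.Injective φ) (hφo : Function.Surjective φ)
    (hφγ : ∀ x, φ ((γ₂ : Matrix (Fin 2) (Fin 2) E).mulVec x) = lam * φ x)
    (hform : ∀ x y, jE (pairing σ H₂ x y) = h * Θ (φ x) * φ y + ρ (h * Θ (φ x) * φ y)) (hΘh : Θ h = h) (hh : h ≠ 0)
    (hfinLS : ∀ j a, (levelSet ρ Θ α (jE ϖ) h j a).Finite)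
    (hf : ∀ (b j : ℕ) (Λ : AddSubgroup M) (x₀ : M) (r : E), 1 ≤ b → x₀ ≠ 0 → (∀ x, x ∈ Λ ↔ ∃ z, IsOrd ρ α (jE ϖ ^ j) z ∧ x = x₀ * z) →
      IsOrd ρ α (jE ϖ ^ j) (dualGen ρ Θ α (jE ϖ ^ j) h x₀) → ¬ IsOrd ρ α (jE ϖ ^ j) (dualGen ρ Θ α (jE ϖ ^ j) h x₀ / jE ϖ) → Valued.v (dualGen ρ Θ α (jE ϖ ^ j) h x₀) = Valued.v (jE ϖ) ^ b →
      (∀ b', (∀ x ∈ Λ, Valued.v (h * Θ x * b' + ρ (h * Θ x * b')) ≤ 1) → (lam - jE ((u : Matrix (Fin 1) (Fin 1) E) 0 0)) * b' ∈ Λ) → IsOrd ρ α (jE ϖ ^ j) lam →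
      jE r = glueUnit ρ Θ α (jE ϖ ^ j) h (jE ϖ) (jE hW) x₀ b →
      f b j Λ = Nat.card {x : 𝒪[E] ⧸ 𝓂[E] ^ (2 * b) // ∃ u' : 𝒪[E], Ideal.Quotient.mk (𝓂[E] ^ (2 * b)) u' = x ∧ Valued.v ((u' : E) * σ u' - r) ≤ Valued.v (ϖ ^ (2 * b))})
    (b : ℕ) (hb2 : 2 * b = m) (hb1 : 1 ≤ b) (haniso : ¬ ∃ x : M, x ≠ 0 ∧ h * Θ x * x + ρ (h * Θ x * x) = 0) (i : ℕ) (hdi : d ≤ i) (hjli : 2 * b + 2 * i ≤ jl) :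
    ((∑ᶠ Λ ∈ levelSetDep ρ Θ α (jE ϖ) h (b + 2 * i) b (lam - jE ((u : Matrix (Fin 1) (Fin 1) E) 0 0)), f b (b + 2 * i) Λ : ℕ) : ℤ) = 0 := by
  rw [rowSize_eq_pow_mul_ncard hD hσσ h2 hρρ hvρ hρj hjv hjfix hΘj hΘΘ hΘρ hvΘ hα hα1 hint hvlam hU hτ hσres hDM hjiso hq hjpow hϖmax hm hjl hH₂σ hhW hhWσ hφs hφi hφo hφγ hform hΘh hh hfinLS hf hb1 (by omega) (by omega),
    ncard_levelSet_far_ramK_aniso hρρ hvρ hΘρ hα1 hU hDM (hρj ϖ) hΘh hh hq hσres hτ haniso hb1 (by omega) (by omega)]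
  push_cast; ring

end Summit.HodgeConjecture.HodgeConjecture.Cruxes.H413.F0P3cDyRamBeta2ConesRowSizesAllD

end
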